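import Summits.CriticalPhenomena.PercolationContinuityZ3.Theorems.PercNearOneGluingNoHeavyLowerTailSahiCombMixCoord
import Summits.CriticalPhenomena.PercolationContinuityZ3.Theorems.PercNearOneGluingNoHeavyLowerTailSahiMixtureHMixFourCanon

/-!
# The comb (tensor-Bernstein) hierarchy for Sahi's `E_k`, XXXV: COMB H-MIX(4) — the ASSEMBLY from its cells (conditional), the two-slot cell,
# transport of three-slot cells along the canonical forms, and the corollary for hitting families of four coordinate sets

Support file of the one-cut programme (crux `NoHeavyLowerTail`, stmt-CriticalPhenomena-4575; cell `prim-masterthm`, seat P3, gen 8;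
`run/shared/lean/prim/prim-masterthm/prim-masterthm-p3/HIERARCHY.md` §15(d)).  The comb-level mirror of `SahiMixture.hereditaryMixture_four_of_canonCells`
(`…SahiMixtureHMixFourCanon`, gen 7): vocabulary `SahiCombHereditary.CombHereditary`, `combHereditary_of_irredundant`, `exists_perm_of_irredundant` (gen 8, XXXIII),
`SahiCombMix.mixCoord`, `biInter_orCoord_eq_mixCoord`, `ex_ind_mixCoord`, `CombHereditary.row_off` (gen 8, XXXIV), `SahiMixture.canonK`,
`SahiMixture.Irredundant.canon_three_four` (gen 7).
* **`combPos_two_mixCoord`** — the generic TWO-slot cell at the comb level: `E_2(mixCoord P_0 Q_0, mixCoord P_1 Q_1) = (1−p_e)²Cov(P) + p_e(1−p_e)[Cov(P) + Cov(Q) +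
  μ(Q_0∖P_0)μ(Q_1∖P_1)] + p_e²Cov(Q)` — comb-positive from the two covariance rows (no certificate).
* `CombCanonThreeSlotCells k` (`k < 4`) and `CombFourSingletonCells` — the CELL INTERFACES (Props): the sixteen three-slot cells of canonical type `canonK k` resp. the sixteen
  singleton four-slot cells, for every `CombHereditary` quadruple of increasing events ignoring `e`, are comb-positive at multidegree `3` resp. `4`.  (To be discharged by
  lifting gen 7's constant-multiplier certificates and closed forms — HIERARCHY §15(d); NOT proved here.)
* `combPos_threeSlot_transport`, `CombHereditary.reindex`, `combPos_threeSlot_of_canon` — transport along permutations of events/slots and the dispatcher.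
* **`combHereditary_orCoord_four_of_cells`** — THE ASSEMBLY: the two interfaces imply COMB H-MIX(4): for increasing `U_0..U_3` ignoring `e` with `CombHereditary U`, every
  `orCoord U e G` is `CombHereditary` (irredundant reduction at the comb level; `m = 2` the two-slot cell, `m = 3` the dispatcher, `m = 4` the singleton cells).
* **`combHereditary_orFamily_four_of_cells`** — hence (under the two interfaces) the hitting family of any FOUR coordinate sets of any finite cube is comb-positive at every
  order (coordinate induction from the empty family).
HONEST FRAMING: the assembly is conditional on the two cell interfaces; nothing here asserts (M⁺-k) or `C_k` for `k ≥ 3`. [this work]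
-/

noncomputable section

open scoped Classical

namespace Summit.CriticalPhenomena.PercolationContinuityZ3.Theorems

open Finset Function
open Literature.Combinatorics.Sahi2008
open Literature.Probability.Percolation.BHK2006 (ind_inter)
open Literature.Probability.Percolation.DecisionTree (ind ind_of_mem ind_of_not_mem ind_nonneg)
open SahiComb
open SahiMixture (Uncovered Irredundant canonK)
open SahiCombDisjunct (orCoord)
open SahiCombHereditary (CombHereditary combHereditary_of_irredundant exists_perm_of_irredundant)

variable {ι : Type} [Fintype ι]

namespace SahiCombMix

/-! ### The generic two-slot cell at the comb level -/

section Two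

variable (e : ι) {P₀ Q₀ P₁ Q₁ : Set (Set ι)} (hP₀ : ∀ b, secAt e b P₀ = P₀) (hQ₀ : ∀ b, secAt e b Q₀ = Q₀) (hP₁ : ∀ b, secAt e b P₁ = P₁)
  (hQ₁ : ∀ b, secAt e b Q₁ = Q₁) (h₀ : P₀ ⊆ Q₀) (h₁ : P₁ ⊆ Q₁)
include hP₀ hQ₀ hP₁ hQ₁ h₀ h₁

/-- **The two-slot cell on the cube in Bernstein form along `p_e`.** [this work] -/
theorem sahiE_two_mixCoord_eq (p : ι → unitInterval) :
    sahiE (bernoulliWeight p) 2 ![ind (mixCoord e P₀ Q₀), ind (mixCoord e P₁ Q₁)]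
      = (1 - (p e : ℝ)) ^ 2 * (ex (bernoulliWeight p) (ind P₀ * ind P₁) - ex (bernoulliWeight p) (ind P₀) * ex (bernoulliWeight p) (ind P₁))
        + (p e : ℝ) * (1 - (p e : ℝ)) * ((ex (bernoulliWeight p) (ind P₀ * ind P₁) - ex (bernoulliWeight p) (ind P₀) * ex (bernoulliWeight p) (ind P₁))
            + (ex (bernoulliWeight p) (ind Q₀ * ind Q₁) - ex (bernoulliWeight p) (ind Q₀) * ex (bernoulliWeight p) (ind Q₁))
            + ex (bernoulliWeight p) (ind Q₀ - ind P₀) * ex (bernoulliWeight p) (ind Q₁ - ind P₁))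
        + (p e : ℝ) ^ 2 * (ex (bernoulliWeight p) (ind Q₀ * ind Q₁) - ex (bernoulliWeight p) (ind Q₀) * ex (bernoulliWeight p) (ind Q₁)) := by
  have hPi : ∀ b : Bool, secAt e b (P₀ ∩ P₁) = P₀ ∩ P₁ := fun b => by rw [secAt_inter, hP₀, hP₁]
  have hQi : ∀ b : Bool, secAt e b (Q₀ ∩ Q₁) = Q₀ ∩ Q₁ := fun b => by rw [secAt_inter, hQ₀, hQ₁]
  have m0 := ex_ind_mixCoord e hP₀ hQ₀ h₀ p
  have m1 := ex_ind_mixCoord e hP₁ hQ₁ h₁ p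
  have m2 : ex (bernoulliWeight p) (ind (mixCoord e P₀ Q₀) * ind (mixCoord e P₁ Q₁))
      = (1 - (p e : ℝ)) * ex (bernoulliWeight p) (ind P₀ * ind P₁) + (p e : ℝ) * ex (bernoulliWeight p) (ind Q₀ * ind Q₁) := by
    rw [ind_mixCoord_mul e h₀ h₁, ex_ind_mixCoord e hPi hQi (Set.inter_subset_inter h₀ h₁) p]
    congr 2 <;> (congr 1; funext ω; exact ind_inter _ _ ω)
  have d0 : ex (bernoulliWeight p) (ind Q₀ - ind P₀) = ex (bernoulliWeight p) (ind Q₀) - ex (bernoulliWeight p) (ind P₀) := SahiCombDisjunct.ex_sub' _ _ _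
  have d1 : ex (bernoulliWeight p) (ind Q₁ - ind P₁) = ex (bernoulliWeight p) (ind Q₁) - ex (bernoulliWeight p) (ind P₁) := SahiCombDisjunct.ex_sub' _ _ _
  rw [sahiE_two_apply]
  simp only [Matrix.cons_val_zero, Matrix.cons_val_one, m0, m1, m2, d0, d1]
  ring

/-- **The two-slot cell is comb-positive from its two covariance rows** (the defect product `μ(Q₀∖P₀)μ(Q₁∖P₁)` is comb-positive outright). [this work] -/
theorem combPos_two_mixCoord
    (cP : CombPos (update (fun _ : ι => 2) e 0) (fun p => ex (bernoulliWeight p) (ind P₀ * ind P₁) - ex (bernoulliWeight p) (ind P₀) * ex (bernoulliWeight p) (ind P₁)))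
    (cQ : CombPos (update (fun _ : ι => 2) e 0) (fun p => ex (bernoulliWeight p) (ind Q₀ * ind Q₁) - ex (bernoulliWeight p) (ind Q₀) * ex (bernoulliWeight p) (ind Q₁))) :
    CombPos (fun _ : ι => 2) (fun p => sahiE (bernoulliWeight p) 2 ![ind (mixCoord e P₀ Q₀), ind (mixCoord e P₁ Q₁)]) := by
  -- the defect moments ignore `e` and are expectations of nonnegative functions
  have hdef : ∀ {P Q : Set (Set ι)}, (∀ b, secAt e b P = P) → (∀ b, secAt e b Q = Q) → P ⊆ Q →
      CombPos (update (fun _ : ι => 1) e 0) (fun p => ex (bernoulliWeight p) (ind Q - ind P)) := by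
    intro P Q hP hQ hPQ
    refine (combPos_ex (ι := ι) (h := ind Q - ind P) fun ω => ?_).of_ignores e fun p s => ?_
    · simp only [Pi.sub_apply]
      by_cases hω : ω ∈ P
      · rw [ind_of_mem hω, ind_of_mem (hPQ hω)]; norm_num
      · rw [ind_of_not_mem hω]; linarith [ind_nonneg Q ω]
    · refine SahiCombDisjunct.ex_update_of_ignores' e (fun ω => ?_) p s
      simp only [Pi.sub_apply]
      rw [← hQ true, ← hP true, ind_secAt_insert, ind_secAt_insert]
  have hD := (hdef hP₀ hQ₀ h₀).mul_of_eq (hdef hP₁ hQ₁ h₁) (m := update (fun _ : ι => 2) e 0) (by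
    funext x; by_cases hx : x = e
    · subst hx; simp
    · simp [hx])
  have d := SahiCombDisjunct.deg_le_three e (le_refl 3) (le_refl 3)
  have d2 : (Pi.single e 2 + update (fun _ : ι => 2) e 0) ≤ fun _ : ι => 2 := fun x => by
    by_cases hx : x = e
    · subst hx; simp
    · simp [hx]
  have t0 := (SahiCombDisjunct.combPos_coord_pow e 0 2).mul_of_le cP d2
  have t1 := (SahiCombDisjunct.combPos_coord_pow e 1 1).mul_of_le ((cP.add cQ).add hD) d2
  have t2 := (SahiCombDisjunct.combPos_coord_pow e 2 0).mul_of_le cQ d2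
  refine ((t0.add t1).add t2).congr fun p => ?_
  rw [sahiE_two_mixCoord_eq e hP₀ hQ₀ hP₁ hQ₁ h₀ h₁ p]
  ring

end Two

/-! ### The cell interfaces -/

/-- **Interface: the sixteen three-slot cells of canonical type `k`** at the comb level — for every finite cube, every quadruple `U` of increasing events ignoring
`e` with `CombHereditary U`, and every `G`, `p ↦ E_3(μ_p; (1_{⋂_{i ∈ canonK k j}(U_i ∪ [G i]{e∈ω})})_j)` is comb-positive at multidegree `3`.  To be proved by lifting the
constant-multiplier certificates of `…SahiMixtureFourCertK*` (HIERARCHY §15(d)); used here as a hypothesis. [this work] -/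
def CombCanonThreeSlotCells (k : Fin 4) : Prop :=
  ∀ (ι : Type) [Fintype ι] (U : Fin 4 → Set (Set ι)) (e : ι), (∀ j, IsUpperSet (U j)) → (∀ (j : Fin 4) (b : Bool), secAt e b (U j) = U j) →
    CombHereditary U → ∀ (G : Fin 4 → Bool),
      CombPos (fun _ : ι => 3) (fun p => sahiE (bernoulliWeight p) 3 (fun j => ind (⋂ i ∈ canonK k j, orCoord U e G i)))

/-- **Interface: the sixteen singleton four-slot cells** at the comb level — `p ↦ E_4(μ_p; (1_{U_j ∪ [G j]{e∈ω}})_j)` is comb-positive at multidegree `4` for every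
`CombHereditary` quadruple of increasing events ignoring `e`.  (`|G| ≤ 1`: rows; `|G| = 2`: the hereditary `(4,2)` identity; `|G| = 3`: the five-row closed form of
`…SahiMixtureOrThreeOfFour`; `|G| = 4`: TOP(4) in defect form — all with constant multipliers, hence liftable; NOT proved here.) [this work] -/
def CombFourSingletonCells : Prop :=
  ∀ (ι : Type) [Fintype ι] (U : Fin 4 → Set (Set ι)) (e : ι), (∀ j, IsUpperSet (U j)) → (∀ (j : Fin 4) (b : Bool), secAt e b (U j) = U j) →
    CombHereditary U → ∀ (G : Fin 4 → Bool),
      CombPos (fun _ : ι => 4) (fun p => sahiE (bernoulliWeight p) 4 (fun j => ind (orCoord U e G j)))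

/-! ### Transport along permutations of events and slots -/

omit [Fintype ι] in
/-- Relabelling the events inside a member of the ∩-closed family of the OR-ed events. [this work] -/
theorem biInter_orCoord_image {n : ℕ} (U : Fin n → Set (Set ι)) (e : ι) (G : Fin n → Bool) (π : Equiv.Perm (Fin n)) (L : Finset (Fin n)) :
    (⋂ i ∈ L.image π, orCoord U e G i) = ⋂ i ∈ L, orCoord (U ∘ π) e (G ∘ π) i := by
  rw [Finset.set_biInter_finset_image]
  rfl

/-- **`CombHereditary` is invariant under relabelling the events.** [this work] -/
theorem _root_.Summit.CriticalPhenomena.PercolationContinuityZ3.Theorems.SahiCombHereditary.CombHereditary.reindex {n : ℕ} {U : Fin n → Set (Set ι)}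
    (hU : CombHereditary U) (π : Equiv.Perm (Fin n)) : CombHereditary (U ∘ π) := by
  intro m K
  refine (hU m (fun j => (K j).image π)).congr fun p => ?_
  congr 1; funext j
  rw [Finset.set_biInter_finset_image]
  rfl

/-- **Transport of a three-slot cell**: if `K (τ j) = π(K' j)` then the cell of `(U, G)` over `K` is the cell of `(U ∘ π, G ∘ π)` over `K'`. [this work] -/
theorem combPos_threeSlot_transport (U : Fin 4 → Set (Set ι)) (e : ι) (G : Fin 4 → Bool) (π : Equiv.Perm (Fin 4)) (τ : Equiv.Perm (Fin 3))
    (K K' : Fin 3 → Finset (Fin 4)) (hK : ∀ j, K (τ j) = (K' j).image π)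
    (h : CombPos (fun _ : ι => 3) (fun p => sahiE (bernoulliWeight p) 3 (fun j => ind (⋂ i ∈ K' j, orCoord (U ∘ π) e (G ∘ π) i)))) :
    CombPos (fun _ : ι => 3) (fun p => sahiE (bernoulliWeight p) 3 (fun j => ind (⋂ i ∈ K j, orCoord U e G i))) := by
  refine h.congr fun p => ?_
  rw [← sahiE_comp_perm (bernoulliWeight p) 3 τ (fun j => ind (⋂ i ∈ K j, orCoord U e G i))]
  congr 1
  funext j
  show ind (⋂ i ∈ K (τ j), orCoord U e G i) = ind (⋂ i ∈ K' j, orCoord (U ∘ π) e (G ∘ π) i)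
  rw [hK j, biInter_orCoord_image]

/-- **Dispatcher**: the canonical cells give every irredundant three-slot cell. [this work] -/
theorem combPos_threeSlot_of_canon (hc : ∀ k, CombCanonThreeSlotCells k) (U : Fin 4 → Set (Set ι)) (e : ι) (hUup : ∀ j, IsUpperSet (U j))
    (hUe : ∀ (j : Fin 4) (b : Bool), secAt e b (U j) = U j) (hU : CombHereditary U) (G : Fin 4 → Bool) (K : Fin 3 → Finset (Fin 4))
    (hK : Irredundant K) :
    CombPos (fun _ : ι => 3) (fun p => sahiE (bernoulliWeight p) 3 (fun j => ind (⋂ i ∈ K j, orCoord U e G i))) := by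
  obtain ⟨π, τ, k, hKc⟩ := hK.canon_three_four
  exact combPos_threeSlot_transport U e G π τ K (canonK k) hKc
    (hc k ι (U ∘ π) e (fun j => hUup (π j)) (fun j b => hUe (π j) b) (hU.reindex π) (G ∘ π))

/-! ### The assembly -/

/-- **COMB H-MIX(4) FROM ITS CELLS.**  If the canonical three-slot cells and the singleton four-slot cells are comb-positive (the two interfaces), then for every finite
cube, every quadruple `U` of increasing events ignoring `e` with `CombHereditary U`, and every `G`, the OR-ed family `(U_j ∪ [G j]{e∈ω})_j` is `CombHereditary`: every row
of its ∩-closed family has nonnegative tensor-Bernstein coefficients.  (Irredundant reduction at the comb level; `m = 2`: the two-slot cell from the hereditary covariance rows;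
`m = 3`: the dispatcher; `m = 4`: singleton index sets.) [this work] -/
theorem combHereditary_orCoord_four_of_cells (hc : ∀ k, CombCanonThreeSlotCells k) (h4 : CombFourSingletonCells) (U : Fin 4 → Set (Set ι)) (e : ι)
    (G : Fin 4 → Bool) (hUup : ∀ j, IsUpperSet (U j)) (hUe : ∀ (j : Fin 4) (b : Bool), secAt e b (U j) = U j) (hU : CombHereditary U) :
    CombHereditary (orCoord U e G) := by
  refine combHereditary_of_irredundant _ fun m K hK => ?_
  have hm : m ≤ 4 := hK.card_le
  -- members of the ∩-closed family of `U` ignore `e`, are nested along `filter`, and have comb-positive covariances off `e`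
  have hsec : ∀ (L : Finset (Fin 4)) (b : Bool), secAt e b (⋂ i ∈ L, U i) = ⋂ i ∈ L, U i := fun L b => secAt_biInter U e hUe L b
  have hsub : ∀ L : Finset (Fin 4), (⋂ i ∈ L, U i) ⊆ ⋂ i ∈ L.filter (fun i => G i = false), U i := fun L =>
    Set.biInter_subset_biInter_left (Finset.filter_subset _ L)
  have hcov : ∀ L L' : Finset (Fin 4), CombPos (update (fun _ : ι => 2) e 0)
      (fun p => ex (bernoulliWeight p) (ind (⋂ i ∈ L, U i) * ind (⋂ i ∈ L', U i))
        - ex (bernoulliWeight p) (ind (⋂ i ∈ L, U i)) * ex (bernoulliWeight p) (ind (⋂ i ∈ L', U i))) := by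
    intro L L'
    refine (hU.row_off e hUe 2 ![L, L']).congr fun p => ?_
    rw [sahiE_two_apply]
    simp only [Matrix.cons_val_zero, Matrix.cons_val_one]
  interval_cases m
  · exact (CombPos.zero _).congr fun _ => sahiE_zero _ _
  · exact (combPos_ex_ind _).congr fun _ => sahiE_one_apply _ _
  · have eK : (fun j => ind (⋂ i ∈ K j, orCoord U e G i)) =
        ![ind (mixCoord e (⋂ i ∈ K 0, U i) (⋂ i ∈ (K 0).filter (fun i => G i = false), U i)),
          ind (mixCoord e (⋂ i ∈ K 1, U i) (⋂ i ∈ (K 1).filter (fun i => G i = false), U i))] := by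
      funext j; fin_cases j <;> simp [biInter_orCoord_eq_mixCoord]
    rw [show (fun p => sahiE (bernoulliWeight p) 2 (fun j => ind (⋂ i ∈ K j, orCoord U e G i)))
        = fun p => sahiE (bernoulliWeight p) 2 ![ind (mixCoord e (⋂ i ∈ K 0, U i) (⋂ i ∈ (K 0).filter (fun i => G i = false), U i)),
          ind (mixCoord e (⋂ i ∈ K 1, U i) (⋂ i ∈ (K 1).filter (fun i => G i = false), U i))] from by rw [eK]]
    exact combPos_two_mixCoord e (hsec _) (hsec _) (hsec _) (hsec _) (hsub _) (hsub _) (hcov _ _) (hcov _ _)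
  · exact combPos_threeSlot_of_canon hc U e hUup hUe hU G K hK
  · obtain ⟨σ, hσ⟩ := exists_perm_of_irredundant hK
    have eK : (fun j => ind (⋂ i ∈ K j, orCoord U e G i)) = fun j => (fun i => ind (orCoord U e G i)) (σ j) := by
      funext j; rw [hσ j, Finset.set_biInter_singleton]
    refine (h4 ι U e hUup hUe hU G).congr fun p => ?_
    rw [eK, sahiE_comp_perm (bernoulliWeight p) 4 σ (fun i => ind (orCoord U e G i))]

/-! ### Corollary: hitting families of four coordinate sets -/

/-- **Under the two cell interfaces, the hitting family of any FOUR coordinate sets of any finite cube is comb-positive at every order** (induction on the activated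
coordinates from the empty family, one comb H-MIX(4) step per coordinate). [this work] -/
theorem combHereditary_orFamily_four_of_cells (hc : ∀ k, CombCanonThreeSlotCells k) (h4 : CombFourSingletonCells) (S : Fin 4 → Finset ι) :
    CombHereditary (fun i => {ω : Set ι | ∃ a ∈ S i, a ∈ ω}) := by
  classical
  suffices key : ∀ T : Finset ι, CombHereditary (fun i => {ω : Set ι | ∃ a ∈ S i ∩ T, a ∈ ω}) by
    have h := key Finset.univ
    simp only [Finset.inter_univ] at h
    exact h
  intro T
  induction T using Finset.induction_on with
  | empty =>
    have e : (fun i : Fin 4 => {ω : Set ι | ∃ a ∈ S i ∩ (∅ : Finset ι), a ∈ ω}) = fun _ => (∅ : Set (Set ι)) := by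
      funext i; ext ω; simp
    rw [e]
    exact SahiCombHereditary.combHereditary_empty 4
  | insert e T heT ih =>
    set W : Fin 4 → Set (Set ι) := fun i => {ω : Set ι | ∃ a ∈ S i ∩ T, a ∈ ω} with hW
    have hWup : ∀ i, IsUpperSet (W i) := fun i => SahiCombDisjunct.isUpperSet_orEvent _
    have hWe : ∀ (i : Fin 4) (b : Bool), secAt e b (W i) = W i := fun i b =>
      SahiCombDisjunct.secAt_orEvent_of_notMem e (S i ∩ T) (fun h => heT (Finset.mem_inter.1 h).2) b
    have hcl' := combHereditary_orCoord_four_of_cells hc h4 W e (fun i => decide (e ∈ S i)) hWup hWe ih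
    have e' : orCoord W e (fun i => decide (e ∈ S i)) = fun i => {ω : Set ι | ∃ a ∈ S i ∩ insert e T, a ∈ ω} := by
      funext i
      unfold SahiCombDisjunct.orCoord
      ext ω
      by_cases hie : e ∈ S i
      · simp only [hie, decide_true, cond_true, hW, Set.mem_union, Set.mem_setOf_eq, Finset.mem_inter, Finset.mem_insert]
        constructor
        · rintro (⟨a, ⟨haS, haT⟩, haω⟩ | hω)
          · exact ⟨a, ⟨haS, Or.inr haT⟩, haω⟩
          · exact ⟨e, ⟨hie, Or.inl rfl⟩, hω⟩
        · rintro ⟨a, ⟨haS, rfl | haT⟩, haω⟩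
          · exact Or.inr haω
          · exact Or.inl ⟨a, ⟨haS, haT⟩, haω⟩
      · simp only [hie, decide_false, cond_false, hW, Set.mem_setOf_eq, Finset.mem_inter, Finset.mem_insert]
        constructor
        · rintro ⟨a, ⟨haS, haT⟩, haω⟩
          exact ⟨a, ⟨haS, Or.inr haT⟩, haω⟩
        · rintro ⟨a, ⟨haS, rfl | haT⟩, haω⟩
          · exact absurd haS hie
          · exact ⟨a, ⟨haS, haT⟩, haω⟩
    rw [e'] at hcl'
    exact hcl'

end SahiCombMix

end Summit.CriticalPhenomena.PercolationContinuityZ3.Theorems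

end
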